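import Literature.AnabelianGeometry.SemiGraphs.PSCGraphicity
import Mathlib.GroupTheory.Coset.Card
import Mathlib.Tactic.Group

/-!
# [CombGC] §1 over the interface: the group-theoretic bookkeeping, proved (Def. 1.1 (ii); Rmk. 1.4.2 counts)

Mochizuki, *A combinatorial version of the Grothendieck conjecture*, Tohoku Math. J. **59** (2007)
[CombGC], §1.  `PSCFundamentalGroup.lean` / `PSCGraphicity.lean` type Definition 1.1, Definition
1.4, Proposition 1.5 and Theorem 1.6 over the interface `PSCDatum Π` (a semi-graph of anabelioids
of pro-Σ PSC-type seen through its PSC-fundamental group).  This proof-only companion discharges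
the parts of §1 that are pure group theory and hold for EVERY datum — no geometric origin needed:

* Definition 1.1 (ii), p. 7: the filtration `M^cusp ⊆ M^edge ⊆ M^vert ⊆ M` of the abelianization
  of a covering (`cuspFil_le_edgeFil`, `edgeFil_le_vertFil`, `vertFil_le`), the position of the
  representative subgroups with respect to the kernels of `Π ↠ Π^cpt ↠ Π^unr ↠ Π^grph`
  (`cuspGp_le_cptKer`, `nodeGp_le_unrKer`, `vertGp_le_grphKer`, …), `Π^unr`-coverings are
  `Π^cpt`-coverings; [cite: MochizukiCombGC2007, Def 1.1(ii) p.7]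
* Definition 1.1 (i)–(ii) / Remark 1.4.2 (bracket "[so `n(G') = deg(G'/G) · n(G)`]"): the cusps
  (nodes, vertices) of the Galois covering attached to an open normal `H` over a cusp `c` are the
  double cosets `H \ Π / Π_c`, in number `[Π : H · Π_c]` (`card_doubleCoset_quotient_eq_index`),
  whence `r(G_H) = r(G) · deg` for `Π^cpt`-coverings and `n(G_H) = n(G) · deg` for
  `Π^unr`-coverings (`cuspCount_eq_of_isCptCovering`, `nodeCount_eq_of_isUnrCovering`);
  [cite: MochizukiCombGC2007, Rmk 1.4.2 p.11]

Companion `PSCGraphicProofs.lean`: what a GRAPHIC `α` preserves (Def. 1.4, Prop. 1.5 (ii) ⇒).  The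
converse directions (Prop. 1.2, Prop. 1.5 (i), (ii) ⇐, Thm. 1.6) use the geometric origin of `G`
and stay named facts over `Ω : PSCOrigin` (FACT policy of the cell).  Pure proofs; no
definitions; nothing here takes a side on [IUTchIII] Cor. 3.12.
-/

noncomputable section

namespace Literature.AnabelianGeometry.SemiGraphs

namespace PSCDatum

open scoped Pointwise

universe u

variable {P : Type u} [Group P] [TopologicalSpace P]

/-! ### Double cosets `H \ Π / K`: counting the cusps, nodes, vertices of a covering -/

section DoubleCosets

omit [TopologicalSpace P] in
/-- For `N ⊴ Π` normal, the double cosets `N \ Π / K` are the cosets of the subgroup `N · K`: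
their number is the index `[Π : N ⊔ K]` (the cusps of the Galois covering `G_N → G` over the cusp
with cuspidal subgroup `K = Π_c` are the `N`-orbits of `Π / Π_c`, [CombGC] Def. 1.1 (i)–(ii), p. 6).
[cite: MochizukiCombGC2007, Def 1.1(ii) p.6] -/
theorem card_doubleCoset_quotient_eq_index (N K : Subgroup P) [hN : N.Normal] :
    Nat.card (DoubleCoset.Quotient (N : Set P) (K : Set P)) = (N ⊔ K).index := by
  rw [Subgroup.index]
  refine Nat.card_congr (Quotient.congrRight fun x y => ?_)
  rw [DoubleCoset.rel_iff, QuotientGroup.leftRel_apply]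
  constructor
  · rintro ⟨a, ha, b, hb, rfl⟩
    have : x⁻¹ * (a * x * b) = (x⁻¹ * a * x) * b := by group
    rw [this]
    exact Subgroup.mul_mem _ (Subgroup.mem_sup_left (hN.conj_mem' a ha x))
      (Subgroup.mem_sup_right hb)
  · intro h
    rw [← SetLike.mem_coe, Subgroup.normal_mul] at h
    obtain ⟨n, hn, k, hk, hnk⟩ := Set.mem_mul.mp h
    refine ⟨x * n * x⁻¹, hN.conj_mem n hn x, k, hk, ?_⟩
    rw [show x * n * x⁻¹ * x * k = x * (n * k) by group, hnk, mul_inv_cancel_left]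

omit [TopologicalSpace P] in
/-- If `N ⊴ Π`, `N ≤ H` and `N · K = Π`, there is exactly one double coset `H \ Π / K` (a covering
intermediate to a covering in which the cusp is totally ramified has one cusp over it; [CombGC]
Rmk. 1.4.2 / [IUTchI] Rmk. 1.2.3 (iii)). [cite: MochizukiCombGC2007, Rmk 1.4.2 p.11] -/
theorem card_doubleCoset_quotient_eq_one {N H K : Subgroup P} [N.Normal] (hNH : N ≤ H)
    (htop : N ⊔ K = ⊤) : Nat.card (DoubleCoset.Quotient (H : Set P) (K : Set P)) = 1 := by
  haveI : Subsingleton (DoubleCoset.Quotient (H : Set P) (K : Set P)) := ⟨fun a b => by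
    rw [← DoubleCoset.out_eq' H K a, ← DoubleCoset.out_eq' H K b, DoubleCoset.eq]
    have hmem : ∀ x : P, ∃ n ∈ N, ∃ k ∈ K, n * k = x := fun x => by
      have hx : x ∈ ((N ⊔ K : Subgroup P) : Set P) := by rw [htop]; exact Subgroup.mem_top x
      rw [Subgroup.normal_mul] at hx
      exact Set.mem_mul.mp hx
    obtain ⟨n, hn, k, hk, hab⟩ := hmem (a.out⁻¹ * b.out)
    refine ⟨a.out * n * a.out⁻¹, hNH (Subgroup.Normal.conj_mem ‹N.Normal› n hn _), k, hk, ?_⟩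
    rw [show a.out * n * a.out⁻¹ * a.out * k = a.out * (n * k) by group, hab,
      mul_inv_cancel_left]⟩
  exact Nat.card_unique

omit [TopologicalSpace P] in
/-- The number of double cosets `H \ Π / K` is at most the index of `H` (each double coset is a
union of right cosets of `H`). [cite: MochizukiCombGC2007, Def 1.1(ii) p.6] -/
theorem card_doubleCoset_quotient_le_index (H K : Subgroup P) [H.FiniteIndex] :
    Nat.card (DoubleCoset.Quotient (H : Set P) (K : Set P)) ≤ H.index := by
  haveI : Finite (Quotient (QuotientGroup.rightRel H)) :=
    Finite.of_equiv _ (QuotientGroup.quotientRightRelEquivQuotientLeftRel H).symm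
  have hcard : Nat.card (Quotient (QuotientGroup.rightRel H)) = H.index :=
    Nat.card_congr (QuotientGroup.quotientRightRelEquivQuotientLeftRel H)
  rw [← hcard]
  refine Nat.card_le_card_of_surjective
    (Quotient.map' id fun x y hxy => ?_) fun q => ?_
  · rw [QuotientGroup.rightRel_apply] at hxy
    rw [DoubleCoset.rel_iff]
    exact ⟨y * x⁻¹, hxy, 1, K.one_mem, by simp⟩
  · induction q using Quotient.inductionOn with
    | h x => exact ⟨Quotient.mk'' x, rfl⟩

end DoubleCosets

variable (G : PSCDatum P)

/-! ### Definition 1.1 (ii): representative subgroups versus the kernels `cptKer ≤ unrKer ≤ grphKer` -/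

section Kernels

variable [IsTopologicalGroup P]

/-- `Ker(Π_G ↠ Π^cpt_G)` is normal (a theorem rather than an instance: proof-only file; use
`haveI := G.cptKer_normal`). [cite: MochizukiCombGC2007, Def 1.1(ii) p.7] -/
theorem cptKer_normal : G.cptKer.Normal := Subgroup.is_normal_topologicalClosure _

/-- `Ker(Π_G ↠ Π^grph_G)` is normal (theorem; `haveI := G.grphKer_normal`).
[cite: MochizukiCombGC2007, Def 1.1(ii) p.7] -/
theorem grphKer_normal : G.grphKer.Normal := Subgroup.is_normal_topologicalClosure _

/-- Every conjugate of a cuspidal subgroup dies in `Π^cpt_G`. [cite: MochizukiCombGC2007, Def 1.1(ii) p.7] -/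
theorem smul_cuspGp_le_cptKer (c : G.graph.C) (γ : ConjAct P) : γ • G.cuspGp c ≤ G.cptKer := by
  rw [← (G.cptKer_normal).conjAct γ, Subgroup.pointwise_smul_le_pointwise_smul_iff]
  exact le_trans (fun x hx => Subgroup.subset_normalClosure (Set.mem_iUnion.mpr ⟨c, hx⟩))
    (Subgroup.le_topologicalClosure _)

/-- `Π_c ≤ Ker(Π_G ↠ Π^cpt_G)`. [cite: MochizukiCombGC2007, Def 1.1(ii) p.7] -/
theorem cuspGp_le_cptKer (c : G.graph.C) : G.cuspGp c ≤ G.cptKer := by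
  simpa using G.smul_cuspGp_le_cptKer c 1

/-- Every conjugate of a cuspidal subgroup dies in `Π^unr_G`. [cite: MochizukiCombGC2007, Def 1.1(ii) p.7] -/
theorem smul_cuspGp_le_unrKer (c : G.graph.C) (γ : ConjAct P) : γ • G.cuspGp c ≤ G.unrKer :=
  (G.smul_cuspGp_le_cptKer c γ).trans G.cptKer_le_unrKer

/-- Every conjugate of a nodal subgroup dies in `Π^unr_G`. [cite: MochizukiCombGC2007, Def 1.1(ii) p.7] -/
theorem smul_nodeGp_le_unrKer (e : G.graph.N) (γ : ConjAct P) : γ • G.nodeGp e ≤ G.unrKer := by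
  rw [← (G.unrKer_normal).conjAct γ, Subgroup.pointwise_smul_le_pointwise_smul_iff]
  exact le_trans (fun x hx => Subgroup.subset_normalClosure (Or.inr (Set.mem_iUnion.mpr ⟨e, hx⟩)))
    (Subgroup.le_topologicalClosure _)

/-- `Π_e ≤ Ker(Π_G ↠ Π^unr_G)` for a node `e`. [cite: MochizukiCombGC2007, Def 1.1(ii) p.7] -/
theorem nodeGp_le_unrKer (e : G.graph.N) : G.nodeGp e ≤ G.unrKer := by
  simpa using G.smul_nodeGp_le_unrKer e 1

/-- Every edge-like subgroup dies in `Π^unr_G`. [cite: MochizukiCombGC2007, Def 1.1(ii) p.7] -/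
theorem le_unrKer_of_isEdgeLike {A : Subgroup P} (hA : G.IsEdgeLike A) : A ≤ G.unrKer := by
  rcases hA with ⟨e, γ, rfl⟩ | ⟨c, γ, rfl⟩
  · exact G.smul_nodeGp_le_unrKer e γ
  · exact G.smul_cuspGp_le_unrKer c γ

/-- Every conjugate of a verticial subgroup dies in `Π^grph_G`. [cite: MochizukiCombGC2007, Def 1.1(ii) p.7] -/
theorem smul_vertGp_le_grphKer (v : G.graph.V) (γ : ConjAct P) : γ • G.vertGp v ≤ G.grphKer := by
  rw [← (G.grphKer_normal).conjAct γ, Subgroup.pointwise_smul_le_pointwise_smul_iff]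
  exact le_trans (fun x hx => Subgroup.subset_normalClosure (Set.mem_iUnion.mpr ⟨v, hx⟩))
    (Subgroup.le_topologicalClosure _)

/-- Every verticial subgroup dies in `Π^grph_G`. [cite: MochizukiCombGC2007, Def 1.1(ii) p.7] -/
theorem le_grphKer_of_isVerticial {A : Subgroup P} (hA : G.IsVerticial A) : A ≤ G.grphKer := by
  obtain ⟨v, γ, rfl⟩ := hA
  exact G.smul_vertGp_le_grphKer v γ

/-- A `Π^unr_G`-covering is a `Π^cpt_G`-covering (`Π ↠ Π^cpt ↠ Π^unr`).
[cite: MochizukiCombGC2007, Def 1.1(ii) p.7] -/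
theorem isCptCovering_of_isUnrCovering {H : Subgroup P} (h : G.IsUnrCovering H) :
    G.IsCptCovering H :=
  G.cptKer_le_unrKer.trans h

/-- An unramified verticial subgroup contains `Ker(Π_G ↠ Π^unr_G)`. [cite: MochizukiCombGC2007, Def 1.1(ii) p.7] -/
theorem unrKer_le_of_isUnrVerticial {B : Subgroup P} (hB : G.IsUnrVerticial B) : G.unrKer ≤ B := by
  obtain ⟨A, -, rfl⟩ := hB
  exact le_sup_right

/-- Conjugates of unramified verticial subgroups are unramified verticial (the images in `Π^unr_G`
of the verticial subgroups form a union of conjugacy classes). [cite: MochizukiCombGC2007, Def 1.1(ii) p.7] -/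
theorem IsUnrVerticial.smul {B : Subgroup P} (hB : G.IsUnrVerticial B) (γ : ConjAct P) :
    G.IsUnrVerticial (γ • B) := by
  obtain ⟨A, ⟨v, δ, rfl⟩, rfl⟩ := hB
  refine ⟨(γ * δ) • G.vertGp v, ⟨v, γ * δ, rfl⟩, ?_⟩
  rw [Subgroup.smul_sup, (G.unrKer_normal).conjAct γ, mul_smul]

end Kernels

/-! ### Definition 1.1 (ii): the filtration `M^cusp ⊆ M^edge ⊆ M^vert ⊆ M` of a covering -/

section Filtration

variable [IsTopologicalGroup P]

omit [IsTopologicalGroup P] in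
/-- Every edge-like subgroup is contained in a verticial subgroup (the branch inclusions
`Π_e ↪ Π_v` of Def. 1.1). [cite: MochizukiCombGC2007, Def 1.1(ii) p.7] -/
theorem exists_isVerticial_ge_of_isEdgeLike {B : Subgroup P} (hB : G.IsEdgeLike B) :
    ∃ B', G.IsVerticial B' ∧ B ≤ B' := by
  rcases hB with ⟨e, γ, rfl⟩ | ⟨c, γ, rfl⟩
  · obtain ⟨v₁, v₂, -, ⟨δ, hδ⟩, -⟩ := G.nodeGp_le e
    refine ⟨(γ * δ⁻¹) • G.vertGp v₁, ⟨v₁, γ * δ⁻¹, rfl⟩, ?_⟩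
    rw [mul_smul, Subgroup.pointwise_smul_le_pointwise_smul_iff, ← inv_smul_smul δ (G.nodeGp e)]
    exact Subgroup.pointwise_smul_le_pointwise_smul_iff.mpr hδ
  · obtain ⟨δ, hδ⟩ := G.cuspGp_le c
    refine ⟨(γ * δ⁻¹) • G.vertGp (G.graph.cuspEnd c), ⟨G.graph.cuspEnd c, γ * δ⁻¹, rfl⟩, ?_⟩
    rw [mul_smul, Subgroup.pointwise_smul_le_pointwise_smul_iff, ← inv_smul_smul δ (G.cuspGp c)]
    exact Subgroup.pointwise_smul_le_pointwise_smul_iff.mpr hδ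

/-- `[Π_{G_H}, Π_{G_H}]` dies in every term of the filtration: `⁅H, H⁆ ≤` the inverse image of
`M^cusp_{G_H}`. [cite: MochizukiCombGC2007, Def 1.1(ii) p.7] -/
theorem commutator_le_cuspFil (H : Subgroup P) : ⁅H, H⁆ ≤ G.cuspFil H :=
  le_sup_left.trans (Subgroup.le_topologicalClosure _)

/-- `M^cusp_{G_H} ⊆ M^edge_{G_H}` (as inverse images in `Π_{G_H} = H`).
[cite: MochizukiCombGC2007, Def 1.1(ii) p.7] -/
theorem cuspFil_le_edgeFil (H : Subgroup P) : G.cuspFil H ≤ G.edgeFil H := by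
  refine Subgroup.topologicalClosure_mono (sup_le_sup_left (iSup_le fun A => ?_) _)
  obtain ⟨A, B, hB, rfl⟩ := A
  exact le_iSup_of_le ⟨H ⊓ B, B, Or.inr hB, rfl⟩ le_rfl

/-- `M^edge_{G_H} ⊆ M^vert_{G_H}` (as inverse images in `Π_{G_H} = H`): every edge-like subgroup
of a covering lies in a verticial one. [cite: MochizukiCombGC2007, Def 1.1(ii) p.7] -/
theorem edgeFil_le_vertFil (H : Subgroup P) : G.edgeFil H ≤ G.vertFil H := by
  refine Subgroup.topologicalClosure_mono (sup_le_sup_left (iSup_le fun A => ?_) _)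
  obtain ⟨A, B, hB, rfl⟩ := A
  obtain ⟨B', hB', hBB'⟩ := G.exists_isVerticial_ge_of_isEdgeLike hB
  exact le_iSup_of_le ⟨H ⊓ B', B', hB', rfl⟩ (inf_le_inf_left H hBB')

/-- `M^vert_{G_H} ⊆ M_{G_H}`: the inverse image of `M^vert` lies in `Π_{G_H} = H` (for `H` closed,
e.g. open). [cite: MochizukiCombGC2007, Def 1.1(ii) p.7] -/
theorem vertFil_le {H : Subgroup P} (hH : IsClosed (H : Set P)) : G.vertFil H ≤ H := by
  refine Subgroup.topologicalClosure_minimal _ (sup_le ?_ (iSup_le fun A => ?_)) hH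
  · rw [Subgroup.commutator_le]
    intro x hx y hy
    rw [commutatorElement_def]
    exact H.mul_mem (H.mul_mem (H.mul_mem hx hy) (H.inv_mem hx)) (H.inv_mem hy)
  · obtain ⟨A, B, -, rfl⟩ := A
    exact inf_le_left

/-- Hence `M^cusp_{G_H} ⊆ M^vert_{G_H}` and `M^edge_{G_H} ⊆ M_{G_H}`, `M^cusp_{G_H} ⊆ M_{G_H}`.
[cite: MochizukiCombGC2007, Def 1.1(ii) p.7] -/
theorem cuspFil_le_vertFil (H : Subgroup P) : G.cuspFil H ≤ G.vertFil H :=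
  (G.cuspFil_le_edgeFil H).trans (G.edgeFil_le_vertFil H)

/-- `M^edge_{G_H} ⊆ M_{G_H}` for `H` closed. [cite: MochizukiCombGC2007, Def 1.1(ii) p.7] -/
theorem edgeFil_le {H : Subgroup P} (hH : IsClosed (H : Set P)) : G.edgeFil H ≤ H :=
  (G.edgeFil_le_vertFil H).trans (G.vertFil_le hH)

/-- `M^cusp_{G_H} ⊆ M_{G_H}` for `H` closed. [cite: MochizukiCombGC2007, Def 1.1(ii) p.7] -/
theorem cuspFil_le {H : Subgroup P} (hH : IsClosed (H : Set P)) : G.cuspFil H ≤ H :=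
  (G.cuspFil_le_vertFil H).trans (G.vertFil_le hH)

end Filtration

/-! ### Counting cusps, nodes, vertices of Galois coverings (Def. 1.1 (i)–(ii); Rmk. 1.4.2) -/

section Counts

/-- For a Galois covering (open NORMAL `H`): `r(G_H) = Σ_c [Π : H · Π_c]`.
[cite: MochizukiCombGC2007, Def 1.1(ii) p.6] -/
theorem cuspCount_eq_sum_index (H : Subgroup P) [H.Normal] :
    G.cuspCount H = ∑ c, (H ⊔ G.cuspGp c).index := by
  simp only [cuspCount, card_doubleCoset_quotient_eq_index]

/-- For a Galois covering: `n(G_H) = Σ_e [Π : H · Π_e]`. [cite: MochizukiCombGC2007, Def 1.1(ii) p.6] -/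
theorem nodeCount_eq_sum_index (H : Subgroup P) [H.Normal] :
    G.nodeCount H = ∑ e, (H ⊔ G.nodeGp e).index := by
  simp only [nodeCount, card_doubleCoset_quotient_eq_index]

/-- For a Galois covering: `i(G_H) = Σ_v [Π : H · Π_v]`. [cite: MochizukiCombGC2007, Def 1.1(ii) p.6] -/
theorem vertCount_eq_sum_index (H : Subgroup P) [H.Normal] :
    G.vertCount H = ∑ v, (H ⊔ G.vertGp v).index := by
  simp only [vertCount, card_doubleCoset_quotient_eq_index]

variable [IsTopologicalGroup P]

/-- For a Galois `Π^cpt_G`-covering, `r(G_H) = r(G) · deg(G_H/G)`: over each cusp there are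
`deg` cusps (no ramification at the cusps). [cite: MochizukiCombGC2007, Rmk 1.4.2 p.11] -/
theorem cuspCount_eq_of_isCptCovering {H : Subgroup P} [H.Normal] (hH : G.IsCptCovering H) :
    G.cuspCount H = G.graph.r * H.index := by
  rw [G.cuspCount_eq_sum_index, Finset.sum_congr rfl fun c _ =>
    congrArg Subgroup.index (sup_of_le_left ((G.cuspGp_le_cptKer c).trans hH)),
    Finset.sum_const, smul_eq_mul, Finset.card_univ]
  rfl

/-- For a Galois `Π^unr_G`-covering, `r(G_H) = r(G) · deg(G_H/G)`.
[cite: MochizukiCombGC2007, Rmk 1.4.2 p.11] -/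
theorem cuspCount_eq_of_isUnrCovering {H : Subgroup P} [H.Normal] (hH : G.IsUnrCovering H) :
    G.cuspCount H = G.graph.r * H.index :=
  G.cuspCount_eq_of_isCptCovering (G.isCptCovering_of_isUnrCovering hH)

/-- For a Galois `Π^unr_G`-covering, `n(G_H) = n(G) · deg(G_H/G)` ([CombGC] Rmk. 1.4.2:
"[so `n(G') = deg(G'/G) · n(G)`]", kept in [IUTchI] Rmk. 1.2.3 (iii)).
[cite: MochizukiCombGC2007, Rmk 1.4.2 p.11] -/
theorem nodeCount_eq_of_isUnrCovering {H : Subgroup P} [H.Normal] (hH : G.IsUnrCovering H) :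
    G.nodeCount H = G.graph.n * H.index := by
  rw [G.nodeCount_eq_sum_index, Finset.sum_congr rfl fun e _ =>
    congrArg Subgroup.index (sup_of_le_left ((G.nodeGp_le_unrKer e).trans hH)),
    Finset.sum_const, smul_eq_mul, Finset.card_univ]
  rfl

end Counts


end PSCDatum

end Literature.AnabelianGeometry.SemiGraphs

end
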